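import Summits.BirchSwinnertonDyer.BirchSwinnertonDyer.Theses.ErratumRoadFive
import Summits.BirchSwinnertonDyer.BirchSwinnertonDyer.Theorems.ErratumRoadFiveIMCDivRoadFFSigmaDataBOfSigmaLocal
import Summits.BirchSwinnertonDyer.BirchSwinnertonDyer.Theorems.ErratumRoadFiveIMCDivRoadFFFittingFrameBOfMembers
import Literature.NumberTheory.EllipticCurves.BigRepModuleShapiroDualityProofs
import HarnessLib

/-!
# Route `ErratumRoadFive` (rung K2, `p ≥ 5`), crux `IMCDivAtErratumDataAllR` (item stmt-BirchSwinnertonDyer-20169)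
# BY THE ROUTE'S NAME from the LOCAL `Σ`-atom instead of the composite JSW17 Prop. 3.3.2 fact — the certificate for a
# DOWN edit of support 20427 `JSWSigmaChangeNoTamagawaDefect`

Cell `bsd-stepL` (run/shared/lean/pub/bsd-stepL/), seat `bsd-stepL-imc-p1` (prover g12, 2026-08-27);
`--supports stmt-BirchSwinnertonDyer-20169 --as helper`. Twin of imc-p1 g11's
`Theorems/ErratumRoadFiveIMCDivAtErratumDataAllROfWeakFacts.lean` (p526343) with the PUBLISHED COMPOSITE binder
`h332 : JetchevSkinnerWan2017.prop332_charIdeal_XAc_sigma_change_of_noTamagawaDefect` (JSW17 Prop. 3.3.2 + proof of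
Thm. 6.1.6 + Thm. 3.3.1: surjectivity of localisation via Poitou–Tate, two-sided `Σ`-change) REPLACED by
* the LOCAL atom `hloc : JetchevSkinnerWan2017.sigmaLocal_charIdeal_eulerFactor_mem_of_noTamagawaDefect` (per place
  `w ∤ p`: `H¹(K_w, T ⊗ Λ^*(Ψ⁻¹))^∨` is f.g. `Λ`-torsion with `P_w ∈ Ch_Λ`; JSW17 proof of Thm. 6.1.6 local display ∕
  Ski16 §2.3 ∕ GV00 Prop. 2.4 ∕ PW11 L. 3.2 + Cas18 (2.7), Prop. 2.5; p543519), and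
* the control theorem `h331 : JetchevSkinnerWan2017.thm331_anticyclotomicControl_mult` (already the K2 binder `h331`,
  item 19626) for the torsion of `X^∅_ac` at each datum,
the one-sided `Σ`-change being PROVED in the tree (`SigmaLocalCharIdealProofs`, `BigGaloisRepSelmerSigmaChangeProofs`,
`CharIdealDualLocalizationStepProofs`; no surjectivity of localisation). The `Σ`-data enter through
`P2.RoadFF.sigmaDataAtErratumDataB_of_sigmaLocal_of_prop323_of_thm331`; the deciding stub and the Road-FF cut are
unchanged (`P2.RoadFF.fittingCongruenceFrameAtErratumDataB_of_members_of_prop323`, p525830;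
`P2.imcDivIntCoreFrameAtErratumDataB_of_roadFF_fitting`, p495387).

## What this file proves

**`imcDivAtErratumDataAllR_of_sigmaLocal_facts`**: the crux
`Summit.BirchSwinnertonDyer.BirchSwinnertonDyer.Theses.ErratumRoadFive.IMCDivAtErratumDataAllR` from SIX named facts —
FIVE PUBLISHED (`sigmaLocal_…` (local), `thm331_anticyclotomicControl_mult`, GZK, modularity, [SU14] Prop. 3.2.3) and
ONE OPEN claim-tagged (`Castella2018.erratum_members_exists_charIdeal_le_of_isTorsion_congruence_OPEN`, item 20529);
and **`imcDivAtErratumDataAllR_of_publishedInputsIMCReduction_of_sigmaLocal_facts`**, keyed to the route's HELD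
bundle `PublishedInputsIMCReduction` (item 19283; GZK = conjunct 2, modularity = conjunct 4) — the shape of the route's
inline `have h3 := …` with `hRF.1` replaced by `(hloc, h331)`.
HONEST FRAMING: a certificate "crux ⟸ named facts"; CONDITIONAL on the six facts, one OPEN and unrefereed; the crux
is NOT proved; the anticyclotomic main conjecture is asserted nowhere; BSD is proved for no pair; no count moves (T7).

References: [JetchevSkinnerWan2017] §5.1, proof of Thm. 6.1.6, Thm. 3.3.1; [Skinner2016PacificMC] §2.3;
[SkinnerUrban2014] Prop. 3.2.3; [GreenbergVatsal2000] Prop. 2.4; [PollackWeston2011] L. 3.2; [Castella2018] (2.7),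
Prop. 2.5, Thm. 3.1; [Castella2018Erratum] (2.4)–(2.5), proof of Thm. 1.1; [FouquetWan2021] Thm. 4.41 (claim).
-/

set_option autoImplicit false
-- the Theorems namespace of this sub repeats the summit name by design (D-0017 nested layout)
set_option linter.dupNamespace false

noncomputable section

open scoped Classical
open WeierstrassCurve NumberField IsDedekindDomain
open Literature.NumberTheory.EllipticCurves Literature.NumberTheory.EllipticCurves.ModularForms
  Literature.NumberTheory.EllipticCurves.Rank1Residual Literature.NumberTheory.EllipticCurves.JetchevSkinnerWan2017
  Literature.NumberTheory.EllipticCurves.Castella2018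
open Summit.BirchSwinnertonDyer.Rank1Residual.X11b

namespace Summit.BirchSwinnertonDyer.BirchSwinnertonDyer.Theorems

/-- **THE CRUX `IMCDivAtErratumDataAllR` BY NAME from the LOCAL `Σ`-atom** (+ control + GZK + modularity + Shapiro +
the OPEN member package in torsion-free premise form): `Σ`-data by
`P2.RoadFF.sigmaDataAtErratumDataB_of_sigmaLocal_of_prop323_of_thm331`, Fitting frame by
`P2.RoadFF.fittingCongruenceFrameAtErratumDataB_of_members_of_prop323`, composed by the Road-FF cut. CONDITIONAL on the
six named facts, ONE of them OPEN and unrefereed; nothing is booked.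
[claim: Castella2018Erratum, status: under-review] [claim: FouquetWan2021, status: under-review]
[cite: Castella2018Erratum, (2.4)–(2.5) and proof of Thm. 1.1 (pp. 3–4)]
[cite: JetchevSkinnerWan2017, proof of Thm. 6.1.6 (local display) and Thm. 3.3.1 with §3.5 (3.5.c)]
[cite: SkinnerUrban2014, Prop. 3.2.3 (Shapiro)] -/
theorem imcDivAtErratumDataAllR_of_sigmaLocal_facts
    (hloc : sigmaLocal_charIdeal_eulerFactor_mem_of_noTamagawaDefect)
    (h331 : thm331_anticyclotomicControl_mult)
    (hGZK : rank_eq_analyticRank_of_analyticRank_le_one) (hnf : exists_isNewformOf)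
    (hSh : SkinnerUrban2014.prop323_XAc_equiv_XBigDecomp)
    (hMem : erratum_members_exists_charIdeal_le_of_isTorsion_congruence_OPEN) :
    Summit.BirchSwinnertonDyer.BirchSwinnertonDyer.Theses.ErratumRoadFive.IMCDivAtErratumDataAllR :=
  fun W _ _ p _ ↦
    P2.imcDivIntCoreFrameAtErratumDataB_of_roadFF_fitting
      (P2.RoadFF.sigmaDataAtErratumDataB_of_sigmaLocal_of_prop323_of_thm331 W p hloc hSh h331 hGZK hnf)
      (P2.RoadFF.fittingCongruenceFrameAtErratumDataB_of_members_of_prop323 hMem hSh W p)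

/-- **The same certificate keyed to the route's HELD bundle `PublishedInputsIMCReduction`** (item 19283; binder `hF` of
K2's `closes`: GZK = conjunct 2, modularity = conjunct 4) — the shape a route-level
`have h3 : IMCDivAtErratumDataAllR := …` takes once support 20427 reads the local atom: `(hloc) (h331) (hF) (hSh) (hMem)`.
CONDITIONAL; nothing booked. [claim: Castella2018Erratum, status: under-review] [claim: FouquetWan2021, status: under-review]
[cite: Castella2018Erratum, (2.4)–(2.5) and proof of Thm. 1.1 (pp. 3–4)]
[cite: JetchevSkinnerWan2017, proof of Thm. 6.1.6 (local display) and Thm. 3.3.1] -/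
theorem imcDivAtErratumDataAllR_of_publishedInputsIMCReduction_of_sigmaLocal_facts
    (hloc : sigmaLocal_charIdeal_eulerFactor_mem_of_noTamagawaDefect)
    (h331 : thm331_anticyclotomicControl_mult)
    (hF : Summit.BirchSwinnertonDyer.BirchSwinnertonDyer.Theses.ErratumRoadFive.PublishedInputsIMCReduction)
    (hSh : SkinnerUrban2014.prop323_XAc_equiv_XBigDecomp)
    (hMem : erratum_members_exists_charIdeal_le_of_isTorsion_congruence_OPEN) :
    Summit.BirchSwinnertonDyer.BirchSwinnertonDyer.Theses.ErratumRoadFive.IMCDivAtErratumDataAllR :=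
  imcDivAtErratumDataAllR_of_sigmaLocal_facts hloc h331 hF.2.1 hF.2.2.2.1 hSh hMem

/-! ### Appended 2026-08-27 (same seat): Shapiro DISCHARGED — [SU14] Prop. 3.2.3 is the tree's THEOREM
`SkinnerUrban2014.prop323_XAc_equiv_XBigDecomp_holds` (defn-ty1 g7, p541834), so the certificate needs no `hSh`. -/

/-- **THE CRUX `IMCDivAtErratumDataAllR` BY NAME from FIVE named facts — FOUR PUBLISHED (the LOCAL `Σ`-atom,
JSW17 Thm. 3.3.1 at multiplicative `p`, GZK, modularity) and ONE OPEN (the member package O15)** — Shapiro being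
supplied by the tree's theorem `prop323_XAc_equiv_XBigDecomp_holds`. CONDITIONAL; nothing booked.
[claim: Castella2018Erratum, status: under-review] [claim: FouquetWan2021, status: under-review]
[cite: Castella2018Erratum, (2.4)–(2.5) and proof of Thm. 1.1 (pp. 3–4)]
[cite: JetchevSkinnerWan2017, proof of Thm. 6.1.6 (local display) and Thm. 3.3.1 with §3.5 (3.5.c)]
[cite: SkinnerUrban2014, Prop. 3.2.3 (Shapiro; the tree's theorem)] -/
theorem imcDivAtErratumDataAllR_of_sigmaLocal_of_thm331
    (hloc : sigmaLocal_charIdeal_eulerFactor_mem_of_noTamagawaDefect)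
    (h331 : thm331_anticyclotomicControl_mult)
    (hGZK : rank_eq_analyticRank_of_analyticRank_le_one) (hnf : exists_isNewformOf)
    (hMem : erratum_members_exists_charIdeal_le_of_isTorsion_congruence_OPEN) :
    Summit.BirchSwinnertonDyer.BirchSwinnertonDyer.Theses.ErratumRoadFive.IMCDivAtErratumDataAllR :=
  imcDivAtErratumDataAllR_of_sigmaLocal_facts hloc h331 hGZK hnf
    SkinnerUrban2014.prop323_XAc_equiv_XBigDecomp_holds hMem

/-- **The route-level `have h3` shape after the «prop323 DOWN» (plan g35, K2 rev ≥ 39: binder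
`hJSW : JSWSigmaChangeNoTamagawaDefect`) and the proposed «sigmaLocal DOWN» (`hJSW := sigmaLocal_…`)**:
`have h3 : IMCDivAtErratumDataAllR := Theorems.imcDivAtErratumDataAllR_of_publishedInputsIMCReduction_of_sigmaLocal hJSW h331 hF hMem`.
CONDITIONAL; nothing booked. [claim: Castella2018Erratum, status: under-review] [claim: FouquetWan2021, status: under-review]
[cite: Castella2018Erratum, (2.4)–(2.5) and proof of Thm. 1.1 (pp. 3–4)]
[cite: JetchevSkinnerWan2017, proof of Thm. 6.1.6 (local display) and Thm. 3.3.1] -/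
theorem imcDivAtErratumDataAllR_of_publishedInputsIMCReduction_of_sigmaLocal
    (hloc : sigmaLocal_charIdeal_eulerFactor_mem_of_noTamagawaDefect)
    (h331 : thm331_anticyclotomicControl_mult)
    (hF : Summit.BirchSwinnertonDyer.BirchSwinnertonDyer.Theses.ErratumRoadFive.PublishedInputsIMCReduction)
    (hMem : erratum_members_exists_charIdeal_le_of_isTorsion_congruence_OPEN) :
    Summit.BirchSwinnertonDyer.BirchSwinnertonDyer.Theses.ErratumRoadFive.IMCDivAtErratumDataAllR :=
  imcDivAtErratumDataAllR_of_sigmaLocal_of_thm331 hloc h331 hF.2.1 hF.2.2.2.1 hMem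

end Summit.BirchSwinnertonDyer.BirchSwinnertonDyer.Theorems

end
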